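/-
Copyright (c) 2026 the pub-hodgecm-mathlib formalisation cell (harness21).  Prover seat hodgecm-mathlib-K2E3-p14 (g4) ((SC-an) line lead), HCML Track B «K2-LIT»
(build stream 29), h413 = `stmt-HodgeConjecture-24833`, line `K2_E3_EllipticInputs`, unit U12 «Characters», socket #11 road (11-SC), letter (SC-an), road «FC»
(FINITE CONJUGATION MEASURE, RULINGS #15 ∕ MAP v5, `K2/STATUS.md` 2026-09-04T03:42:59Z), brick (FC-6b), FILE 1 OF 2 «THE σ-ADJOINT, THE LAGRANGE IDEMPOTENT OF A SPLIT
CHARACTERISTIC POLYNOMIAL, AND ITS ADJOINT» (pure algebra; FILE 2 `K2E3NearSingularOfCompactCentralizer` adds the valuations and the head).  2026-09-04.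
-/
import Mathlib.LinearAlgebra.Matrix.Charpoly.Coeff
import Mathlib.LinearAlgebra.Matrix.ToLinearEquiv
import Mathlib.RingTheory.Coprime.Lemmas
import HarnessLib

/-!
# h413 ∕ Track B «K2-LIT», road «FC» (finite conjugation measure), brick (FC-6b) FILE 1: THE `σ`-ADJOINT `A⋆ = J ᵗ(σA) J`, THE LAGRANGE IDEMPOTENT `e₀` OF A
# UNITARY `A` WITH SPLIT CHARACTERISTIC POLYNOMIAL, AND `f = e₀⋆`: `A f = σ(λ₀)⁻¹ f`, `σ(λ₀)⁻¹ ∈ {λᵢ}`, and `e₀ f = f e₀ = 0` WHEN THE ROOT INVOLUTION MOVES `λ₀`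

Cell `pub/hodgecm-mathlib`, crux H413 = `stmt-HodgeConjecture-24833`, route of record `HCCMUnconditional`; lane `--supports stmt-HodgeConjecture-24833 --as helper`
(count-neutral).  THEOREMS ONLY (no `def`, no `instance`, no `notation`, no named-fact hypothesis, no `sorry`).  Dealer K2E3-plan (g3); (SC-an) line lead K2E3-p14 (g4)
(RULINGS #15–#17, `K2/STATUS.md` 2026-09-04T03:42–03:47Z).

THE ROAD «FC».  The (SC-an) consumer ★ p856355 `sigSCan_datum_of_bricks` needs on the elliptic set only an `L¹_loc` majorant of `g ↦ ∫‖θ(xgx⁻¹)‖dx`; road FC pays it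
with `W_E(g) = ‖θ‖_∞ ∫ β(xgx⁻¹) dx` and proves `W_E ∈ L¹_loc` by Tonelli in `x` first, the Cartan decomposition `U = ⋃_d K₀ t_d K₀` (★ `K2E3WittCartan`), a coset count, and
the present brick: an element `g` of the box `Ω_M ∩ t_d⁻¹ Ω_M t_d` (upper entries of depth `d`) whose centraliser is COMPACT must have two `exp(−k)`-close diagonal entries.
(FC-6a) (★-to-be `K2E3NearTriangularEigenvalues`, K2E5-p01 (g4)) supplies, when the diagonal is `exp(−k)`-SEPARATED, three `K`-rational eigenvalues `λᵢ` of `g` with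
`v(λᵢ − gᵢᵢ) ≤ exp(3M + 2k − d)`; FILE 2 shows that such a `g ∈ U(σ, Φ₃)(K)` has a NON-compact centraliser (the contrapositive is what FC-8 consumes); THIS FILE is its
pure-algebra engine (any field `K`, any `σ` with `σ² = id`, any `J` with `J² = 1`, `σJ = J = Jᵀ`; no valuation, no topology).

THE MATHEMATICS (elementary; [Rogawski1990, §3.5–§3.6] for the torus bookkeeping, [PlatonovRapinchuk1994, §3.3] for «anisotropic ⟺ compact»).  Write `A = ↑g`,
`A⋆ := J ᵗ(σA) J` (`J = Φ₃ = J⁻¹`), so `g ∈ U ⟺ A⋆A = 1 ⟺ A⋆ = A⁻¹`, and `⋆` is a `σ`-semilinear anti-involution.  Let `e₀ := L₀(A)` be the Lagrange idempotent of the root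
`λ₀ ≈ g₀₀` (`L₀ = c₀(X−λ₁)(X−λ₂)`): `e₀² = e₀`, `A e₀ = λ₀ e₀`, `e₀ ≠ 0` (Cayley–Hamilton + an eigenvector).  Put `f := e₀⋆`: an idempotent, `≠ 0`, commuting with `A`, and
`A f = μ f` with `μ = σ(λ₀)⁻¹` (apply `⋆` to `A e₀ = λ₀ e₀`); `μ` is an eigenvalue, hence one of the `λⱼ`.  UNITARITY NEAR THE BOREL: `g ∈ U` with upper entries of depth `d`
forces `σ(g₂₂) g₀₀ ≡ 1`, so `μ ≈ g₂₂`, and the separation `v(g₀₀ − g₂₂) ≥ exp(−k)` gives `μ ≠ λ₀` — the root involution MOVES `λ₀`.  Then `e₀ f = L₀(μ) f = 0 = f e₀`, and for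
`a ∈ K^×` the element `y_a := 1 + (a − 1)e₀ + (σ(a)⁻¹ − 1) f` satisfies `y_a⋆ y_a = 1` and commutes with `A`: `y_a ∈ Z_U(g)`.  Its entries grow like `|a|` along a non-zero entry
of `e₀`, so `Z_U(g)` lies in no compact set.  (At a non-split place the compact centralisers are exactly the anisotropic tori `(K¹)³`, `K¹ × E¹`, `M¹`; the split torus
`K^× × K¹` is what `y_a` exhibits.)

* §1 the `σ`-adjoint `A ↦ J ᵗ(σA) J` for `J² = 1`, `σ² = id` (anti-multiplicative, additive, `σ`-semilinear, involutive; `g ∈ U ⟺ A⋆A = 1`);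
* §2 the Lagrange idempotent `e₀` of a split characteristic polynomial with distinct roots; `f = e₀⋆`, `A f = σ(λ₀)⁻¹ f`;
* §2b `f = e₀⋆`: **`mul_adjLagrange_eq_smul`** (`A f = σ(λ₀)⁻¹ f`), **`exists_inv_sigma_lam_zero_eq`** (`σ(λ₀)⁻¹ = λᵢ` for some `i`), **`lagrange_mul_adjLagrange_eq_zero`**
  (`σ(λ₀)⁻¹ ≠ λ₀ ⇒ e₀ f = 0 = f e₀`); FILE 2 (`K2E3NearSingularOfCompactCentralizer`) adds §3 (valuations on the box ⇒ `σ(λ₀)⁻¹ ≠ λ₀`) and §4 (`y_a ∈ Z_U(g)`, the head).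

HONEST LABEL.  HC_CM is proved only modulo the 7 printed citations (2 remaining named inputs: hLiu418 = `stmt-HodgeConjecture-24832`, h413 = `stmt-HodgeConjecture-24833`)
until rung 0 closes; this file is a count-neutral helper of road FC ((SC-an) is NOT ★: ★ modulo the elliptic weight, ★ p857093 ∕ (M5h‴)).

## References
* [Rogawski1990] J. D. Rogawski, *Automorphic Representations of Unitary Groups in Three Variables*, Ann. of Math. Stud. 123 (1990), §1.9–§1.10 p. 9 (the form `Φ₃`,
  `g⁻¹ = Φ ᵗḡ Φ`), §3.5 p. 29, §3.6 pp. 31–32 (tori of `U(3)`, elliptic = anisotropic).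
* [PlatonovRapinchuk1994] V. Platonov, A. Rapinchuk, *Algebraic Groups and Number Theory* (1994), §3.3 (a torus over a local field is anisotropic iff its points are compact).
* [HarishChandra1970] Harish-Chandra (notes by G. van Dijk), *Harmonic Analysis on Reductive p-adic Groups*, LNM 162 (1970), Part VII §3 pp. 70–73 (the consumer).
-/

set_option autoImplicit false
-- the mandated namespace repeats the single-problem summit's segment (`HodgeConjecture.HodgeConjecture`)
set_option linter.dupNamespace false

noncomputable section

open Matrix Polynomial

namespace Summit.HodgeConjecture.HodgeConjecture.Cruxes.H413.K2E3UnitaryAdjointIdempotent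

/-! ## §1 The `σ`-adjoint `A ↦ J ᵗ(σA) J` -/

section Adjoint

variable {K : Type*} [Field K] (σ : K →+* K) (hσ : ∀ x, σ (σ x) = x) {n : ℕ} {J : Matrix (Fin n) (Fin n) K}
  (hJJ : J * J = 1) (hJσ : J.map σ = J) (hJT : Jᵀ = J)

omit hσ in
/-- `(A B)⋆ = B⋆ A⋆` for `A⋆ = J ᵗ(σA) J`, `J² = 1`. [cite: Rogawski1990, §1.9–§1.10 p. 9] -/
theorem adj_mul (hJJ : J * J = 1) (A B : Matrix (Fin n) (Fin n) K) :
    J * ((A * B).map σ)ᵀ * J = (J * (B.map σ)ᵀ * J) * (J * (A.map σ)ᵀ * J) := by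
  rw [Matrix.map_mul, Matrix.transpose_mul]
  simp only [Matrix.mul_assoc]
  rw [← Matrix.mul_assoc J J, hJJ, Matrix.one_mul]

/-- `(A + B)⋆ = A⋆ + B⋆`. [cite: Rogawski1990, §1.9–§1.10 p. 9] -/
theorem adj_add (A B : Matrix (Fin n) (Fin n) K) :
    J * ((A + B).map σ)ᵀ * J = J * (A.map σ)ᵀ * J + J * (B.map σ)ᵀ * J := by
  have h : (A + B).map σ = A.map σ + B.map σ := by
    ext i j; simp only [Matrix.map_apply, Matrix.add_apply, map_add]
  rw [h, Matrix.transpose_add, Matrix.mul_add, Matrix.add_mul]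

/-- `(c • A)⋆ = σ(c) • A⋆`. [cite: Rogawski1990, §1.9–§1.10 p. 9] -/
theorem adj_smul (c : K) (A : Matrix (Fin n) (Fin n) K) :
    J * ((c • A).map σ)ᵀ * J = σ c • (J * (A.map σ)ᵀ * J) := by
  have h : (c • A).map σ = σ c • A.map σ := by
    ext i j; simp only [Matrix.map_apply, Matrix.smul_apply, smul_eq_mul, map_mul]
  rw [h, Matrix.transpose_smul, Matrix.mul_smul, Matrix.smul_mul]

/-- `1⋆ = 1` (`σ 1 = 1`, `J² = 1`). [cite: Rogawski1990, §1.9–§1.10 p. 9] -/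
theorem adj_one (hJJ : J * J = 1) : J * ((1 : Matrix (Fin n) (Fin n) K).map σ)ᵀ * J = 1 := by
  rw [Matrix.map_one σ (map_zero σ) (map_one σ), Matrix.transpose_one, Matrix.mul_one, hJJ]

include hσ in
/-- `A⋆⋆ = A` (`σ² = id`, `σJ = J`, `Jᵀ = J`, `J² = 1`). [cite: Rogawski1990, §1.9–§1.10 p. 9] -/
theorem adj_adj (hJJ : J * J = 1) (hJσ : J.map σ = J) (hJT : Jᵀ = J) (A : Matrix (Fin n) (Fin n) K) :
    J * ((J * (A.map σ)ᵀ * J).map σ)ᵀ * J = A := by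
  have hAσ : (A.map σ).map σ = A := by
    ext i j; simp only [Matrix.map_apply, hσ]
  have h1 : ((J * (A.map σ)ᵀ * J).map σ)ᵀ = J * A * J := by
    rw [Matrix.map_mul, Matrix.map_mul, hJσ, Matrix.transpose_map, hAσ, Matrix.transpose_mul, Matrix.transpose_mul, Matrix.transpose_transpose, hJT,
      Matrix.mul_assoc]
  rw [h1]
  simp only [← Matrix.mul_assoc]
  rw [hJJ, Matrix.one_mul, Matrix.mul_assoc, hJJ, Matrix.mul_one]

end Adjoint

/-! ## §2 Split characteristic polynomial with distinct roots: the Lagrange idempotent and its adjoint -/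

section Lagrange

variable {K : Type*} [Field K] {A : Matrix (Fin 3) (Fin 3) K} {lam : Fin 3 → K}
  (hp : A.charpoly = ∏ i, (X - C (lam i))) (hinj : Function.Injective lam)

include hp hinj in
/-- **Cayley–Hamilton for a split characteristic polynomial with distinct roots**: a polynomial vanishing at the three roots kills `A`. [cite: Rogawski1990, §3.5 p. 29] -/
theorem aeval_eq_zero_of_forall_isRoot {q : K[X]} (hq : ∀ i, q.IsRoot (lam i)) : aeval A q = 0 := by
  have hdvd : (∏ i, (X - C (lam i))) ∣ q :=
    Fintype.prod_dvd_of_coprime (Polynomial.pairwise_coprime_X_sub_C hinj) fun i => dvd_iff_isRoot.2 (hq i)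
  obtain ⟨r, hr⟩ := hdvd
  rw [hr, map_mul, ← hp, Matrix.aeval_self_charpoly, zero_mul]

omit hp hinj in
/-- The values of `L₀ = c₀ (X−λ₁)(X−λ₂)` at the three roots: `1, 0, 0`. [folklore] -/
theorem eval_lagrange (hinj : Function.Injective lam) (i : Fin 3) :
    eval (lam i) (C ((lam 0 - lam 1) * (lam 0 - lam 2))⁻¹ * ((X - C (lam 1)) * (X - C (lam 2)))) = if i = 0 then 1 else 0 := by
  have h01 : lam 0 - lam 1 ≠ 0 := sub_ne_zero.2 (hinj.ne (by decide))
  have h02 : lam 0 - lam 2 ≠ 0 := sub_ne_zero.2 (hinj.ne (by decide))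
  simp only [eval_mul, eval_C, eval_sub, eval_X]
  fin_cases i
  · simp only [Fin.zero_eta, Fin.isValue, ↓reduceIte]
    exact inv_mul_cancel₀ (mul_ne_zero h01 h02)
  · simp only [Fin.mk_one, Fin.isValue, sub_self, zero_mul, mul_zero, one_ne_zero, ↓reduceIte]
  · simp only [Fin.reduceFinMk, Fin.isValue, sub_self, mul_zero, Fin.reduceEq, ↓reduceIte]

include hp hinj in
/-- The Lagrange idempotent `e₀ = L₀(A)`, `L₀ = c₀ (X−λ₁)(X−λ₂)`, `c₀ = ((λ₀−λ₁)(λ₀−λ₂))⁻¹`, is an idempotent: `e₀² = e₀` (`L₀² − L₀` vanishes at `λ₀, λ₁, λ₂`).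
[cite: Rogawski1990, §3.5 p. 29] -/
theorem lagrange_mul_self :
    aeval A (C ((lam 0 - lam 1) * (lam 0 - lam 2))⁻¹ * ((X - C (lam 1)) * (X - C (lam 2)))) *
        aeval A (C ((lam 0 - lam 1) * (lam 0 - lam 2))⁻¹ * ((X - C (lam 1)) * (X - C (lam 2)))) =
      aeval A (C ((lam 0 - lam 1) * (lam 0 - lam 2))⁻¹ * ((X - C (lam 1)) * (X - C (lam 2)))) := by
  rw [← map_mul, ← sub_eq_zero, ← map_sub]
  refine aeval_eq_zero_of_forall_isRoot hp hinj fun i => ?_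
  rw [IsRoot.def, eval_sub, eval_mul, eval_lagrange hinj]
  split_ifs <;> simp

include hp hinj in
/-- `A · e₀ = λ₀ · e₀` (`(X − λ₀) L₀` vanishes at all three roots). [cite: Rogawski1990, §3.5 p. 29] -/
theorem mul_lagrange_eq_smul :
    A * aeval A (C ((lam 0 - lam 1) * (lam 0 - lam 2))⁻¹ * ((X - C (lam 1)) * (X - C (lam 2)))) =
      lam 0 • aeval A (C ((lam 0 - lam 1) * (lam 0 - lam 2))⁻¹ * ((X - C (lam 1)) * (X - C (lam 2)))) := by
  have h : (A - lam 0 • (1 : Matrix (Fin 3) (Fin 3) K)) * aeval A (C ((lam 0 - lam 1) * (lam 0 - lam 2))⁻¹ * ((X - C (lam 1)) * (X - C (lam 2)))) = 0 := by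
    have h1 : A - lam 0 • (1 : Matrix (Fin 3) (Fin 3) K) = aeval A (X - C (lam 0)) := by
      rw [map_sub, aeval_X, aeval_C, Algebra.algebraMap_eq_smul_one]
    rw [h1, ← map_mul]
    refine aeval_eq_zero_of_forall_isRoot hp hinj fun i => ?_
    rw [IsRoot.def, eval_mul, eval_lagrange hinj, eval_sub, eval_X, eval_C]
    split_ifs with hi
    · rw [hi, sub_self, zero_mul]
    · rw [mul_zero]
  rw [Matrix.sub_mul, sub_eq_zero, Matrix.smul_mul, Matrix.one_mul] at h
  exact h

omit hp hinj in
/-- Polynomials in `A` commute with `A`. [folklore] -/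
theorem aeval_mul_self_comm (q : K[X]) : aeval A q * A = A * aeval A q :=
  calc aeval A q * A = aeval A q * aeval A (X : K[X]) := by rw [aeval_X]
    _ = aeval A (X * q) := by rw [← map_mul, mul_comm]
    _ = A * aeval A q := by rw [map_mul, aeval_X]

include hp in
/-- A root `λ₀` of the characteristic polynomial has an eigenvector, on which `e₀` acts as the identity: `e₀ ≠ 0`. [cite: Rogawski1990, §3.5 p. 29] -/
theorem lagrange_ne_zero (hinj : Function.Injective lam) :
    aeval A (C ((lam 0 - lam 1) * (lam 0 - lam 2))⁻¹ * ((X - C (lam 1)) * (X - C (lam 2)))) ≠ 0 := by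
  have h01 : lam 0 - lam 1 ≠ 0 := sub_ne_zero.2 (hinj.ne (by decide))
  have h02 : lam 0 - lam 2 ≠ 0 := sub_ne_zero.2 (hinj.ne (by decide))
  -- an eigenvector for `λ₀`
  have hdet : (Matrix.scalar (Fin 3) (lam 0) - A).det = 0 := by
    rw [← Matrix.eval_charpoly, hp, eval_prod]
    exact Finset.prod_eq_zero (Finset.mem_univ 0) (by simp)
  obtain ⟨v, hv0, hv⟩ := Matrix.exists_mulVec_eq_zero_iff.2 hdet
  have hAv : A *ᵥ v = lam 0 • v := by
    have h1 : (Matrix.scalar (Fin 3) (lam 0)) *ᵥ v - A *ᵥ v = 0 := by rw [← Matrix.sub_mulVec, hv]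
    have h2 : (Matrix.scalar (Fin 3) (lam 0)) *ᵥ v = lam 0 • v := by
      rw [Matrix.scalar_apply, ← Matrix.smul_one_eq_diagonal, Matrix.smul_mulVec, Matrix.one_mulVec]
    rw [sub_eq_zero, h2] at h1
    exact h1.symm
  intro h0
  -- `e₀ v = v`
  have hw : (A - lam 2 • (1 : Matrix (Fin 3) (Fin 3) K)) *ᵥ v = (lam 0 - lam 2) • v := by
    rw [Matrix.sub_mulVec, hAv, Matrix.smul_mulVec, Matrix.one_mulVec, sub_smul]
  have hw2 : (A - lam 1 • (1 : Matrix (Fin 3) (Fin 3) K)) *ᵥ ((lam 0 - lam 2) • v) = ((lam 0 - lam 1) * (lam 0 - lam 2)) • v := by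
    rw [Matrix.mulVec_smul, Matrix.sub_mulVec, hAv, Matrix.smul_mulVec, Matrix.one_mulVec, ← sub_smul, smul_smul, mul_comm]
  have hexp : aeval A (C ((lam 0 - lam 1) * (lam 0 - lam 2))⁻¹ * ((X - C (lam 1)) * (X - C (lam 2)))) =
      (((lam 0 - lam 1) * (lam 0 - lam 2))⁻¹ • (1 : Matrix (Fin 3) (Fin 3) K)) * ((A - lam 1 • 1) * (A - lam 2 • 1)) := by
    rw [map_mul, map_mul, map_sub, map_sub, aeval_X, aeval_C, aeval_C, aeval_C, Algebra.algebraMap_eq_smul_one, Algebra.algebraMap_eq_smul_one,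
      Algebra.algebraMap_eq_smul_one]
  have key : (aeval A (C ((lam 0 - lam 1) * (lam 0 - lam 2))⁻¹ * ((X - C (lam 1)) * (X - C (lam 2))))) *ᵥ v = v := by
    rw [hexp, ← Matrix.mulVec_mulVec, ← Matrix.mulVec_mulVec, hw, hw2, Matrix.smul_mulVec, Matrix.one_mulVec, smul_smul,
      inv_mul_cancel₀ (mul_ne_zero h01 h02), one_smul]
  rw [h0, Matrix.zero_mulVec] at key
  exact hv0 key.symm

end Lagrange

/-! ## §2b The adjoint idempotent `f = e₀⋆` of a unitary `A`: `A f = σ(λ₀)⁻¹ f` -/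

section AdjointIdempotent

variable {K : Type*} [Field K] (σ : K →+* K) (hσ : ∀ x, σ (σ x) = x) {J : Matrix (Fin 3) (Fin 3) K}
  (hJJ : J * J = 1) (hJσ : J.map σ = J) (hJT : Jᵀ = J) {A : Matrix (Fin 3) (Fin 3) K} (hA : J * (A.map σ)ᵀ * J * A = 1)
  {lam : Fin 3 → K} (hp : A.charpoly = ∏ i, (X - C (lam i))) (hinj : Function.Injective lam)

omit hσ in
/-- Polynomials in `A` act on an eigen-matrix by evaluation: `A f = μ f ⇒ q(A) f = q(μ) f`. [folklore] -/
theorem aeval_mul_eq_eval_smul {f : Matrix (Fin 3) (Fin 3) K} {μ : K} (h : A * f = μ • f) (q : K[X]) :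
    aeval A q * f = q.eval μ • f := by
  induction q using Polynomial.induction_on' with
  | add p q hp hq => rw [map_add, Matrix.add_mul, hp, hq, eval_add, add_smul]
  | monomial k c =>
    have hpow : ∀ m : ℕ, A ^ m * f = μ ^ m • f := by
      intro m
      induction m with
      | zero => rw [pow_zero, Matrix.one_mul, pow_zero, one_smul]
      | succ m ih => rw [pow_succ, Matrix.mul_assoc, h, Matrix.mul_smul, ih, smul_smul, pow_succ, mul_comm]
    rw [← C_mul_X_pow_eq_monomial, map_mul, map_pow, aeval_C, aeval_X, Algebra.algebraMap_eq_smul_one, Matrix.mul_assoc, hpow, Matrix.smul_mul,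
      Matrix.one_mul, smul_smul, eval_mul, eval_C, eval_pow, eval_X]

omit hσ in
/-- Polynomials in `A` commute with whatever commutes with `A`. [folklore] -/
theorem commute_aeval_of_commute {f : Matrix (Fin 3) (Fin 3) K} (h : Commute A f) (q : K[X]) : Commute (aeval A q) f := by
  induction q using Polynomial.induction_on' with
  | add p q hp hq => rw [map_add]; exact hp.add_left hq
  | monomial k c =>
    rw [← C_mul_X_pow_eq_monomial, map_mul, map_pow, aeval_C, aeval_X, Algebra.algebraMap_eq_smul_one, Matrix.smul_mul, Matrix.one_mul]
    exact (h.pow_left k).smul_left c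

include hA in
/-- `A A⋆ = 1` from `A⋆ A = 1` (square matrices). [cite: Rogawski1990, §1.9 p. 9] -/
theorem mul_adj_eq_one : A * (J * (A.map σ)ᵀ * J) = 1 :=
  mul_eq_one_comm.1 hA

include hA hp in
/-- A unitary `A` has non-zero eigenvalues. [cite: Rogawski1990, §3.5 p. 29] -/
theorem lam_ne_zero (i : Fin 3) : lam i ≠ 0 := by
  intro h0
  have hdet : A.det ≠ 0 := by
    intro hd
    have h1 := congrArg Matrix.det hA
    rw [Matrix.det_mul, hd, mul_zero, Matrix.det_one] at h1
    exact zero_ne_one h1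
  have hroot : (Matrix.scalar (Fin 3) (lam i) - A).det = 0 := by
    rw [← Matrix.eval_charpoly, hp, eval_prod]
    exact Finset.prod_eq_zero (Finset.mem_univ i) (by simp)
  rw [h0, map_zero, zero_sub, Matrix.det_neg, hdet.isUnit.mul_left_eq_zero] at hroot
  exact pow_ne_zero _ (neg_ne_zero.2 one_ne_zero) hroot

include hJJ hp hinj in
/-- `f = e₀⋆` is an idempotent. [cite: Rogawski1990, §3.5 p. 29] -/
theorem adjLagrange_mul_self :
    (J * ((aeval A (C ((lam 0 - lam 1) * (lam 0 - lam 2))⁻¹ * ((X - C (lam 1)) * (X - C (lam 2))))).map σ)ᵀ * J) *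
        (J * ((aeval A (C ((lam 0 - lam 1) * (lam 0 - lam 2))⁻¹ * ((X - C (lam 1)) * (X - C (lam 2))))).map σ)ᵀ * J) =
      J * ((aeval A (C ((lam 0 - lam 1) * (lam 0 - lam 2))⁻¹ * ((X - C (lam 1)) * (X - C (lam 2))))).map σ)ᵀ * J := by
  rw [← adj_mul σ hJJ, lagrange_mul_self hp hinj]

include hσ hJJ hJσ hJT hp hinj in
/-- `f = e₀⋆ ≠ 0` (`⋆` is involutive and `e₀ ≠ 0`). [cite: Rogawski1990, §3.5 p. 29] -/
theorem adjLagrange_ne_zero :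
    J * ((aeval A (C ((lam 0 - lam 1) * (lam 0 - lam 2))⁻¹ * ((X - C (lam 1)) * (X - C (lam 2))))).map σ)ᵀ * J ≠ 0 := by
  intro h0
  have h := adj_adj σ hσ hJJ hJσ hJT (aeval A (C ((lam 0 - lam 1) * (lam 0 - lam 2))⁻¹ * ((X - C (lam 1)) * (X - C (lam 2)))))
  rw [h0, Matrix.map_zero σ (map_zero σ), Matrix.transpose_zero, Matrix.mul_zero, Matrix.zero_mul] at h
  exact lagrange_ne_zero hp hinj h.symm

include hA hJJ hp hinj in
/-- **`A f = σ(λ₀)⁻¹ f` for `f = e₀⋆`**: apply `⋆` to `e₀ A = λ₀ e₀` and use `A A⋆ = 1`. [cite: Rogawski1990, §3.5 p. 29] -/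
theorem mul_adjLagrange_eq_smul :
    A * (J * ((aeval A (C ((lam 0 - lam 1) * (lam 0 - lam 2))⁻¹ * ((X - C (lam 1)) * (X - C (lam 2))))).map σ)ᵀ * J) =
      (σ (lam 0))⁻¹ • (J * ((aeval A (C ((lam 0 - lam 1) * (lam 0 - lam 2))⁻¹ * ((X - C (lam 1)) * (X - C (lam 2))))).map σ)ᵀ * J) := by
  set e := aeval A (C ((lam 0 - lam 1) * (lam 0 - lam 2))⁻¹ * ((X - C (lam 1)) * (X - C (lam 2)))) with he
  have h1 : e * A = lam 0 • e := by rw [he, aeval_mul_self_comm, mul_lagrange_eq_smul hp hinj]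
  -- apply `⋆`
  have h2 : J * ((e * A).map σ)ᵀ * J = J * ((lam 0 • e).map σ)ᵀ * J := by rw [h1]
  rw [adj_mul σ hJJ, adj_smul σ] at h2
  -- multiply by `A` on the left and use `A A⋆ = 1`
  have h3 : A * (J * (A.map σ)ᵀ * J * (J * (e.map σ)ᵀ * J)) = A * (σ (lam 0) • (J * (e.map σ)ᵀ * J)) := by rw [h2]
  rw [← Matrix.mul_assoc, mul_adj_eq_one σ hA, Matrix.one_mul, Matrix.mul_smul] at h3
  have hσ0 : σ (lam 0) ≠ 0 := (map_ne_zero σ).2 (lam_ne_zero σ hA hp 0)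
  conv_rhs => rw [h3]
  rw [smul_smul, inv_mul_cancel₀ hσ0, one_smul]

include hA hJJ in
omit hp hinj in
/-- `f = e₀⋆` commutes with `A` (it commutes with `A⋆ = A⁻¹`). [cite: Rogawski1990, §3.5 p. 29] -/
theorem commute_adjLagrange :
    Commute A (J * ((aeval A (C ((lam 0 - lam 1) * (lam 0 - lam 2))⁻¹ * ((X - C (lam 1)) * (X - C (lam 2))))).map σ)ᵀ * J) := by
  set e := aeval A (C ((lam 0 - lam 1) * (lam 0 - lam 2))⁻¹ * ((X - C (lam 1)) * (X - C (lam 2)))) with he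
  have h1 : e * A = A * e := by rw [he, aeval_mul_self_comm]
  have h2 : J * ((e * A).map σ)ᵀ * J = J * ((A * e).map σ)ᵀ * J := by rw [h1]
  rw [adj_mul σ hJJ, adj_mul σ hJJ] at h2
  -- `h2 : A⋆ f = f A⋆`; conjugate by `A`
  have h3 : A * (J * (A.map σ)ᵀ * J * (J * (e.map σ)ᵀ * J)) * A = A * (J * (e.map σ)ᵀ * J * (J * (A.map σ)ᵀ * J)) * A := by rw [h2]
  rw [← Matrix.mul_assoc A, mul_adj_eq_one σ hA, Matrix.one_mul, Matrix.mul_assoc A, Matrix.mul_assoc (J * (e.map σ)ᵀ * J), hA, Matrix.mul_one] at h3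
  exact h3.symm

include hσ hJJ hJσ hJT hA hp hinj in
/-- **The root involution moves `λ₀` onto a root**: `σ(λ₀)⁻¹ = λᵢ` for some `i` (an eigen-column of `f ≠ 0`). [cite: Rogawski1990, §3.5 p. 29] -/
theorem exists_inv_sigma_lam_zero_eq : ∃ i : Fin 3, (σ (lam 0))⁻¹ = lam i := by
  set f := J * ((aeval A (C ((lam 0 - lam 1) * (lam 0 - lam 2))⁻¹ * ((X - C (lam 1)) * (X - C (lam 2))))).map σ)ᵀ * J with hf
  have hf0 : f ≠ 0 := adjLagrange_ne_zero σ hσ hJJ hJσ hJT hp hinj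
  have hAf : A * f = (σ (lam 0))⁻¹ • f := mul_adjLagrange_eq_smul σ hJJ hA hp hinj
  -- a non-zero column of `f`
  obtain ⟨i, j, hij⟩ : ∃ i j, f i j ≠ 0 := by
    by_contra h
    push Not at h
    exact hf0 (Matrix.ext fun i j => h i j)
  have hcol : (Matrix.scalar (Fin 3) ((σ (lam 0))⁻¹) - A) *ᵥ (fun k => f k j) = 0 := by
    have h1 : A *ᵥ (fun k => f k j) = (σ (lam 0))⁻¹ • (fun k => f k j) := by
      ext k
      have := congrFun (congrFun hAf k) j
      rw [Matrix.mul_apply] at this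
      simpa [Matrix.mulVec, dotProduct, Matrix.smul_apply] using this
    rw [Matrix.sub_mulVec, h1, Matrix.scalar_apply, ← Matrix.smul_one_eq_diagonal, Matrix.smul_mulVec, Matrix.one_mulVec, sub_self]
  have hdet : (Matrix.scalar (Fin 3) ((σ (lam 0))⁻¹) - A).det = 0 :=
    Matrix.exists_mulVec_eq_zero_iff.1 ⟨fun k => f k j, fun h => hij (by simpa using congrFun h i), hcol⟩
  rw [← Matrix.eval_charpoly, hp, eval_prod, Finset.prod_eq_zero_iff] at hdet
  obtain ⟨i, -, hi⟩ := hdet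
  exact ⟨i, by simpa [sub_eq_zero] using hi⟩

include hσ hJJ hJσ hJT hA hp hinj in
/-- **If the root involution MOVES `λ₀` (`σ(λ₀)⁻¹ ≠ λ₀`) then `e₀ f = 0 = f e₀`.** [cite: Rogawski1990, §3.5 p. 29] -/
theorem lagrange_mul_adjLagrange_eq_zero (hne : (σ (lam 0))⁻¹ ≠ lam 0) :
    aeval A (C ((lam 0 - lam 1) * (lam 0 - lam 2))⁻¹ * ((X - C (lam 1)) * (X - C (lam 2)))) *
        (J * ((aeval A (C ((lam 0 - lam 1) * (lam 0 - lam 2))⁻¹ * ((X - C (lam 1)) * (X - C (lam 2))))).map σ)ᵀ * J) = 0 ∧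
      (J * ((aeval A (C ((lam 0 - lam 1) * (lam 0 - lam 2))⁻¹ * ((X - C (lam 1)) * (X - C (lam 2))))).map σ)ᵀ * J) *
        aeval A (C ((lam 0 - lam 1) * (lam 0 - lam 2))⁻¹ * ((X - C (lam 1)) * (X - C (lam 2)))) = 0 := by
  have hAf := mul_adjLagrange_eq_smul σ hJJ hA hp hinj
  have hcomm := commute_adjLagrange σ hJJ hA (lam := lam)
  obtain ⟨i, hi⟩ := exists_inv_sigma_lam_zero_eq σ hσ hJJ hJσ hJT hA hp hinj
  have hi0 : i ≠ 0 := fun h => hne (by rw [hi, h])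
  have h1 : aeval A (C ((lam 0 - lam 1) * (lam 0 - lam 2))⁻¹ * ((X - C (lam 1)) * (X - C (lam 2)))) *
      (J * ((aeval A (C ((lam 0 - lam 1) * (lam 0 - lam 2))⁻¹ * ((X - C (lam 1)) * (X - C (lam 2))))).map σ)ᵀ * J) = 0 := by
    rw [aeval_mul_eq_eval_smul hAf, hi, eval_lagrange hinj, if_neg hi0, zero_smul]
  refine ⟨h1, ?_⟩
  rw [← (commute_aeval_of_commute hcomm _).eq, h1]

end AdjointIdempotent



end Summit.HodgeConjecture.HodgeConjecture.Cruxes.H413.K2E3UnitaryAdjointIdempotent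

end
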